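import Summits.AnomalousDissipation.AnomalousDissipation.Theorems.EnsembleRigidityGPMeanBoundedFamilyStubSymmetricScheme
import Literature.Analysis.FluidPDE.SteadyGalerkinApprox

/-!
# Stub `stub_symmSteadyGalerkinGP` (S1) of line `Sketch` (crux stmt-AnomalousDissipation-15151,
  `VirtualDissipation.LightSteadyStatesGP`)

`G`-symmetric STATIONARY Galerkin approximations of `NS_ν(f_GP)` on the punctured frequency balls
`S_N = {0 < |k|² ≤ N²}` of `T³` (Temam 1979, Ch. II, §1, Thm. 1.2, proof part (i), run inside the
fixed space of the stabiliser `G` of the Galloway–Proctor force `f_GP = gpForce`):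

* `exists_galerkinRHS_eq_zero_of_invariant` — the acute-angle lemma
  (`Brouwer.exists_zero_of_bilin_coercive`) on a submodule `W ≤ galerkinSubspace S` mapped into
  itself by the Galerkin field; the coercivity estimate is verbatim that of the tree's
  `exists_galerkinRHS_eq_zero` (it only uses `c ∈ galerkinSubspace S`).
* `exists_symmetric_steady_galerkin_approx` — the symmetric version of the tree's
  `exists_steady_galerkin_approx` (any dimension, any finite list of affine symmetries
  `A y = (ε_j y_{σ j} + b_j)_j`, `ε = ±1`, of a smooth force): `W` is the subspace of coefficient
  vectors with the twisted covariance `ĉ(Qk) = e_{-Qk}(b) Q ĉ(k)` of `exists_symmetric_scheme`,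
  invariant by `galerkinField_signedPerm`; covariance of `realTrigPoly S C` is read off the
  coefficients (`symmetric_of_mFourierCoeff`).
* `stub_symmSteadyGalerkinGP` — `d = 3`, `f = gpForce` (`G`-symmetric by `isGPSymmetric_gpForce`,
  the three generators of `isGPSymmetric_iff`), bounds by `steady_galerkin_bounds`.
-/

noncomputable section

-- every `Summit.AnomalousDissipation.AnomalousDissipation.…` name repeats the summit = sub-problem segment (D-0017 layout)
set_option linter.dupNamespace false

namespace Summit.AnomalousDissipation.AnomalousDissipation.Theorems.VirtualDissipation.LightSteadyStatesGP

open MeasureTheory Filter Topology UnitAddTorus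
open scoped InnerProductSpace ENNReal
open Literature.Analysis.FunctionSpaces Literature.Analysis.FluidPDE
open Summit.AnomalousDissipation.AnomalousDissipation.Theorems.EnsembleRigidity

namespace StubSymmSteadyGalerkin

open GPMeanBoundedFamily.StubSymmetricScheme

variable {d : Type*} [Fintype d] [DecidableEq d]

/-- **Stationary Galerkin solutions in an invariant subspace** (Temam 1979, Ch. II, §1, proof of
Thm. 1.2 (i) via Lemma 1.4, run in a subspace): for `ν > 0`, a symmetric `S ∌ 0`, real force
coefficients `g` and a submodule `W` of the Galerkin phase space mapped into itself by the
Galerkin field, the field has a zero in `W` — the acute-angle lemma on `W` for the `ℓ²` form,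
with the coercivity estimate of `exists_galerkinRHS_eq_zero`.
[cite: Temam1979, Ch. II Thm. 1.2 (proof (i)), Lemma 1.4] -/
theorem exists_galerkinRHS_eq_zero_of_invariant {S : Finset (d → ℤ)} {ν : ℝ} (hν : 0 < ν)
    (hS : ∀ k ∈ S, -k ∈ S) (hS0 : (0 : d → ℤ) ∉ S) {g : ↥S → EuclideanSpace ℂ d}
    (hg : Torus.IsRealCoeff g) (W : Submodule ℝ (↥S → EuclideanSpace ℂ d))
    (hWle : W ≤ galerkinSubspace S) (hWinv : ∀ c ∈ W, galerkinRHS S ν g c ∈ W) :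
    ∃ c ∈ W, galerkinRHS S ν g c = 0 := by
  -- adapted from `Literature.Analysis.FluidPDE.exists_galerkinRHS_eq_zero` (phase space `W`)
  have hsmul : ∀ (a : ℝ) (x : EuclideanSpace ℂ d), a • x = (a : ℂ) • x := fun a x => by
    ext i
    simp only [PiLp.smul_apply, Complex.real_smul, smul_eq_mul]
  obtain ⟨B₀, hB₀⟩ : ∃ B₀ : (↥S → EuclideanSpace ℂ d) →ₗ[ℝ] (↥S → EuclideanSpace ℂ d) →ₗ[ℝ] ℝ,
      ∀ c c', B₀ c c' = ∑ k : ↥S, (inner ℂ (c k) (c' k)).re :=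
    ⟨LinearMap.mk₂ ℝ (fun c c' => ∑ k : ↥S, (inner ℂ (c k) (c' k)).re)
      (fun c₁ c₂ c' => by
        simp only [Pi.add_apply, inner_add_left, Complex.add_re, Finset.sum_add_distrib])
      (fun a c c' => by
        simp only [Pi.smul_apply, hsmul, inner_smul_left, Complex.conj_ofReal,
          Complex.re_ofReal_mul, Finset.mul_sum, smul_eq_mul])
      (fun c c₁ c₂ => by
        simp only [Pi.add_apply, inner_add_right, Complex.add_re, Finset.sum_add_distrib])
      (fun a c c' => by
        simp only [Pi.smul_apply, hsmul, inner_smul_right, Complex.re_ofReal_mul,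
          Finset.mul_sum, smul_eq_mul]),
      fun _ _ => rfl⟩
  obtain ⟨B, hB_apply⟩ : ∃ B : W →ₗ[ℝ] W →ₗ[ℝ] ℝ, ∀ c c' : W, B c c' =
      ∑ k : ↥S, (inner ℂ ((c : ↥S → EuclideanSpace ℂ d) k) ((c' : ↥S → EuclideanSpace ℂ d) k)).re :=
    ⟨B₀.compl₁₂ W.subtype W.subtype, fun c c' => hB₀ _ _⟩
  have hB_self : ∀ c : W, B c c = ∑ k : ↥S, ‖(c : ↥S → EuclideanSpace ℂ d) k‖ ^ 2 := by
    intro c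
    rw [hB_apply]
    refine Finset.sum_congr rfl fun k _ => ?_
    rw [← RCLike.re_to_complex, inner_self_eq_norm_sq]
  have hB_pos : ∀ c : W, c ≠ 0 → 0 < B c c := by
    intro c hc
    rw [hB_self]
    have hc' : (c : ↥S → EuclideanSpace ℂ d) ≠ 0 := fun h => hc (Subtype.ext h)
    obtain ⟨k, hk⟩ : ∃ k, (c : ↥S → EuclideanSpace ℂ d) k ≠ 0 := Function.ne_iff.1 hc'
    exact lt_of_lt_of_le (pow_pos (norm_pos_iff.2 hk) 2)
      (Finset.single_le_sum (f := fun k => ‖(c : ↥S → EuclideanSpace ℂ d) k‖ ^ 2)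
        (fun k _ => sq_nonneg _) (Finset.mem_univ k))
  -- the field `-V` on `W`
  obtain ⟨V, hVc, hV⟩ : ∃ V : W → W, Continuous V ∧
      ∀ c : W, ((V c : W) : ↥S → EuclideanSpace ℂ d) = -galerkinRHS S ν g c :=
    ⟨fun c => ⟨-galerkinRHS S ν g c, W.neg_mem (hWinv c c.2)⟩,
      Continuous.subtype_mk
        ((continuous_galerkinRHS ν).comp (continuous_const.prodMk continuous_subtype_val)).neg _,
      fun c => rfl⟩
  -- coercivity
  obtain ⟨γ, hγ⟩ : ∃ γ : ℝ, γ = ∑ k : ↥S, ‖g k‖ ^ 2 := ⟨_, rfl⟩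
  have hden : 0 < 4 * Real.pi ^ 2 * ν := by positivity
  have hcoer : ∀ c : W, γ / (4 * Real.pi ^ 2 * ν) ^ 2 ≤ B c c → 0 ≤ B (V c) c := by
    intro c hrc
    have hcY : (c : ↥S → EuclideanSpace ℂ d) ∈ galerkinSubspace S := hWle c.2
    obtain ⟨b, hb⟩ : ∃ b : ℝ, b = ∑ k : ↥S, ‖(c : ↥S → EuclideanSpace ℂ d) k‖ ^ 2 := ⟨_, rfl⟩
    have hb0 : 0 ≤ b := by rw [hb]; exact Finset.sum_nonneg fun k _ => sq_nonneg _
    rw [hB_self, ← hb] at hrc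
    have hVB : B (V c) c =
        ν * (Torus.eGradNormSq (Torus.realTrigPoly S
          (Torus.coeffExt S (c : ↥S → EuclideanSpace ℂ d)))).toReal -
          ∫ x, ⟪Torus.realTrigPoly S (Torus.coeffExt S g) x,
            Torus.realTrigPoly S (Torus.coeffExt S (c : ↥S → EuclideanSpace ℂ d)) x⟫_ℝ := by
      rw [hB_apply]
      have h1 : ∀ k : ↥S, (inner ℂ (((V c : W) : ↥S → EuclideanSpace ℂ d) k)
          ((c : ↥S → EuclideanSpace ℂ d) k)).re =
          -(inner ℂ ((c : ↥S → EuclideanSpace ℂ d) k) (galerkinRHS S ν g c k)).re := by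
        intro k
        rw [← inner_conj_symm, Complex.conj_re, hV c, Pi.neg_apply, inner_neg_right, Complex.neg_re]
      simp only [h1, Finset.sum_neg_distrib, sum_re_inner_galerkinRHS_self ν hS hg hcY]
      ring
    rw [hVB, Torus.toReal_eGradNormSq_realTrigPoly hS (hcY.1.isConjSymm_coeffExt hS),
      Torus.sum_coeffExt (fun k v => Torus.freqNormSq k * ‖v‖ ^ 2)]
    have hpair := integral_inner_realTrigPoly_coeffExt_le hS hg hcY.1
    rw [← hγ, ← hb] at hpair
    have hbE := sum_norm_sq_le_sum_freqNormSq_mul hS0 (c : ↥S → EuclideanSpace ℂ d)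
    rw [← hb] at hbE
    have h2 : γ ≤ (4 * Real.pi ^ 2 * ν) ^ 2 * b := by
      rw [div_le_iff₀ (by positivity)] at hrc
      linarith
    have h1 : Real.sqrt γ ≤ 4 * Real.pi ^ 2 * ν * Real.sqrt b := by
      calc Real.sqrt γ ≤ Real.sqrt ((4 * Real.pi ^ 2 * ν) ^ 2 * b) := Real.sqrt_le_sqrt h2
        _ = 4 * Real.pi ^ 2 * ν * Real.sqrt b := by
          rw [Real.sqrt_mul (sq_nonneg _), Real.sqrt_sq hden.le]
    have hsqrt : Real.sqrt γ * Real.sqrt b ≤ ν * (4 * Real.pi ^ 2 * b) := by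
      calc Real.sqrt γ * Real.sqrt b ≤ 4 * Real.pi ^ 2 * ν * Real.sqrt b * Real.sqrt b :=
            mul_le_mul_of_nonneg_right h1 (Real.sqrt_nonneg _)
        _ = ν * (4 * Real.pi ^ 2 * b) := by
            rw [mul_assoc, Real.mul_self_sqrt hb0]; ring
    have hE : ν * (4 * Real.pi ^ 2 * b) ≤
        ν * (4 * Real.pi ^ 2 * ∑ k : ↥S, Torus.freqNormSq (k : d → ℤ) *
          ‖(c : ↥S → EuclideanSpace ℂ d) k‖ ^ 2) :=
      mul_le_mul_of_nonneg_left (mul_le_mul_of_nonneg_left hbE (by positivity)) hν.le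
    linarith
  obtain ⟨c, hc⟩ :=
    Literature.Topology.Euclidean.Brouwer.exists_zero_of_bilin_coercive B hB_pos hVc hcoer
  refine ⟨c, c.2, ?_⟩
  have h := hV c
  rw [hc, Submodule.coe_zero] at h
  exact neg_eq_zero.1 h.symm

/-- **Symmetric stationary Galerkin approximations** (Temam 1979, Ch. II, §1, proof of Thm. 1.2,
(1.25)–(1.30), run in a symmetry class): for `ν > 0`, a smooth force `f` on `T^d` covariant under
a finite list of affine symmetries `A y = (ε_j y_{σ j} + b_j)_j` (`ε = ±1`), and `N`, there is a
conjugate-symmetric transversal coefficient family `C` supported in the punctured ball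
`S = {0 < |k|² ≤ N²}` with the a priori bound `(4π²ν)² ∑ |k|²‖C k‖² ≤ ∫‖f‖²`, whose field
`u = realTrigPoly S C` is covariant under every `A` and solves the tested Galerkin equations
`∫ (⟪u, (u·∇)a⟫ + ν⟪u, Δa⟫ + ⟪f, a⟫) = 0` for smooth divergence-free `a` band-limited to `S`.
The zero is produced by `exists_galerkinRHS_eq_zero_of_invariant` in the subspace of coefficient
vectors with the twisted covariance `ĉ(Qk) = e_{-Qk}(b) Q ĉ(k)` (`galerkinField_signedPerm`).
[cite: Temam1979, Ch. II Thm. 1.2 (proof, (1.25)–(1.30))] -/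
theorem exists_symmetric_steady_galerkin_approx {ν : ℝ} (hν : 0 < ν)
    (G : List (Equiv.Perm d × (d → ℤ) × UnitAddTorus d))
    (hG : ∀ p ∈ G, ∀ j, p.2.1 j = 1 ∨ p.2.1 j = -1) {f : UnitAddTorus d → EuclideanSpace ℝ d}
    (hf : Torus.IsSmooth f) (hfG : ∀ p ∈ G, ∀ (y : UnitAddTorus d) (i : d),
      f (fun j => p.2.1 j • y (p.1 j) + p.2.2 j) i = (p.2.1 i : ℝ) * f y (p.1 i)) (N : ℕ) :
    ∃ C : (d → ℤ) → EuclideanSpace ℂ d,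
      Torus.IsConjSymm C ∧ (∀ k, ∑ j, (k j : ℂ) * C k j = 0) ∧
      (∀ k ∉ (Torus.freqBall (d := d) N).erase 0, C k = 0) ∧
      (4 * Real.pi ^ 2 * ν) ^ 2 *
          (∑ k ∈ (Torus.freqBall (d := d) N).erase 0, Torus.freqNormSq k * ‖C k‖ ^ 2) ≤
        ∫ x, ‖f x‖ ^ 2 ∧
      (∀ p ∈ G, ∀ (y : UnitAddTorus d) (i : d),
        Torus.realTrigPoly ((Torus.freqBall (d := d) N).erase 0) C
            (fun j => p.2.1 j • y (p.1 j) + p.2.2 j) i =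
          (p.2.1 i : ℝ) * Torus.realTrigPoly ((Torus.freqBall (d := d) N).erase 0) C y (p.1 i)) ∧
      ∀ a : UnitAddTorus d → EuclideanSpace ℝ d, Torus.IsSmooth a → Torus.IsDivFree a →
        (∀ k ∉ (Torus.freqBall (d := d) N).erase 0,
          mFourierCoeff (EuclideanSpace.complexify ∘ a) k = 0) →
        ∫ x, (⟪Torus.realTrigPoly ((Torus.freqBall (d := d) N).erase 0) C x,
            Torus.convect (Torus.realTrigPoly ((Torus.freqBall (d := d) N).erase 0) C) a x⟫_ℝ +
          ν * ⟪Torus.realTrigPoly ((Torus.freqBall (d := d) N).erase 0) C x,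
            Torus.laplacian a x⟫_ℝ + ⟪f x, a x⟫_ℝ) = 0 := by
  -- adapted from `exists_steady_galerkin_approx` and `exists_symmetric_scheme`
  set S : Finset (d → ℤ) := (Torus.freqBall (d := d) N).erase 0 with hSdef
  have hS : ∀ k ∈ S, -k ∈ S := neg_mem_freqBall_erase_zero
  have hS0 : (0 : d → ℤ) ∉ S := by simp [hSdef]
  -- `S` is stable under the signed permutations `Q`
  have hSQ : ∀ p ∈ G, ∀ k : d → ℤ, (fun j => p.2.1 j * k (p.1 j)) ∈ S ↔ k ∈ S := by
    intro p hp k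
    have hn := freqNormSq_signedPerm p.1 (hG p hp) (Q := fun k j => p.2.1 j * k (p.1 j))
      (fun _ _ => rfl) k
    have hz : ∀ k : d → ℤ, k = 0 ↔ Torus.freqNormSq k = 0 := fun k =>
      (Torus.freqNormSq_eq_zero_iff k).symm
    simp only [hSdef, Finset.mem_erase, Torus.mem_freqBall, Ne, hz, hn]
  have hφ : ∀ p ∈ G, ∀ l m : d → ℤ, mFourier (-fun j => p.2.1 j * (l + m) (p.1 j)) p.2.2 =
      mFourier (-fun j => p.2.1 j * l (p.1 j)) p.2.2 *
        mFourier (-fun j => p.2.1 j * m (p.1 j)) p.2.2 := by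
    intro p _ l m
    rw [← mFourier_add]
    exact congrArg (mFourier · p.2.2) (funext fun j => by
      simp only [Pi.neg_apply, Pi.add_apply]; ring)
  -- the force coefficients: real, with covariant extension by zero
  have hfi : Integrable f volume := hf.integrable
  set g : ↥S → EuclideanSpace ℂ d := fun k =>
    mFourierCoeff (EuclideanSpace.complexify ∘ f) (k : d → ℤ) with hgdef
  have hgr : Torus.IsRealCoeff g := Torus.isRealCoeff_mFourierCoeff hfi
  have hgfix : ∀ p ∈ G, ∀ (k : d → ℤ) (i : d),
      Torus.coeffExt _ g (fun j => p.2.1 j * k (p.1 j)) i = mFourier (-fun j =>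
        p.2.1 j * k (p.1 j)) p.2.2 * ((p.2.1 i : ℂ) * Torus.coeffExt _ g k (p.1 i)) := by
    intro p hp k i
    by_cases hk : k ∈ S
    · rw [Torus.coeffExt_of_mem _ ((hSQ p hp k).2 hk), Torus.coeffExt_of_mem _ hk]
      exact mFourierCoeff_of_symmetric p.1 (hG p hp) (fun _ _ => rfl) p.2.2 hf.continuous
        (hfG p hp) k i
    · rw [Torus.coeffExt_of_not_mem _ (fun h => hk ((hSQ p hp k).1 h)),
        Torus.coeffExt_of_not_mem _ hk]
      simp
  -- the symmetric subspace of the Galerkin phase space, invariant under the Galerkin field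
  let W : Submodule ℝ (↥S → EuclideanSpace ℂ d) :=
    { carrier := {c | c ∈ galerkinSubspace S ∧ ∀ p ∈ G, ∀ (k : d → ℤ) (i : d),
        Torus.coeffExt _ c (fun j => p.2.1 j * k (p.1 j)) i = mFourier (-fun j =>
          p.2.1 j * k (p.1 j)) p.2.2 * ((p.2.1 i : ℂ) * Torus.coeffExt _ c k (p.1 i))}
      zero_mem' := ⟨Submodule.zero_mem _, fun p _ k i => by simp⟩
      add_mem' := fun {c c'} hc hc' => ⟨Submodule.add_mem _ hc.1 hc'.1, fun p hp k i => by
        rw [Torus.coeffExt_add, Pi.add_apply, PiLp.add_apply, Pi.add_apply, PiLp.add_apply,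
          hc.2 p hp k i, hc'.2 p hp k i]
        ring⟩
      smul_mem' := fun a c hc => ⟨Submodule.smul_mem _ a hc.1, fun p hp k i => by
        rw [Torus.coeffExt_smul, Pi.smul_apply, PiLp.smul_apply, Pi.smul_apply, PiLp.smul_apply,
          hc.2 p hp k i]
        simp only [Complex.real_smul]
        ring⟩ }
  have hWle : W ≤ galerkinSubspace S := fun c hc => hc.1
  have hWinv : ∀ c ∈ W, galerkinRHS S ν g c ∈ W := by
    intro c hc
    refine ⟨galerkinRHS_mem ν hS hgr hc.1, fun p hp k i => ?_⟩
    by_cases hk : k ∈ S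
    · rw [Torus.coeffExt_of_mem _ ((hSQ p hp k).2 hk), Torus.coeffExt_of_mem _ hk,
        galerkinRHS_apply, galerkinRHS_apply]
      exact galerkinField_signedPerm p.1 (hG p hp) (fun _ _ => rfl) ν (hSQ p hp) (hφ p hp)
        (hgfix p hp) (hc.2 p hp) k i
    · rw [Torus.coeffExt_of_not_mem _ (fun h => hk ((hSQ p hp k).1 h)),
        Torus.coeffExt_of_not_mem _ hk]
      simp
  -- the symmetric stationary Galerkin solution
  obtain ⟨c, hcW, h0⟩ := exists_galerkinRHS_eq_zero_of_invariant hν hS hS0 hgr W hWle hWinv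
  have hc : c ∈ galerkinSubspace S := hWle hcW
  have hCsymm : Torus.IsConjSymm (Torus.coeffExt S c) := hc.1.isConjSymm_coeffExt hS
  have hCT : Torus.IsTransversal S (Torus.coeffExt S c) := hc.2.isTransversal_coeffExt
  have hGg : Torus.realTrigPoly S (Torus.coeffExt S g) =
      Torus.realTrigPoly S fun k => mFourierCoeff (EuclideanSpace.complexify ∘ f) k :=
    Torus.realTrigPoly_coeffExt_restrict _
  refine ⟨Torus.coeffExt S c, hCsymm, ?_, fun k hk => Torus.coeffExt_of_not_mem c hk, ?_, ?_, ?_⟩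
  · intro k
    by_cases hk : k ∈ S
    · exact hCT k hk
    · simp [Torus.coeffExt_of_not_mem c hk]
  · -- a priori bound
    have h1 := sum_freqNormSq_mul_norm_sq_le_of_galerkinRHS_eq_zero hν hS hS0 hgr hc h0
    rw [← Torus.sum_coeffExt (fun k v => Torus.freqNormSq k * ‖v‖ ^ 2) c] at h1
    refine h1.trans ?_
    calc ∑ k : ↥S, ‖g k‖ ^ 2
        = ∑ k ∈ S, ‖mFourierCoeff (EuclideanSpace.complexify ∘ f) k‖ ^ 2 :=
          Finset.sum_coe_sort S fun k => ‖mFourierCoeff (EuclideanSpace.complexify ∘ f) k‖ ^ 2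
      _ ≤ ∫ x, ‖f x‖ ^ 2 :=
          sum_le_hasSum S (fun k _ => sq_nonneg _)
            (Torus.hasSum_sq_norm_mFourierCoeff_complexify (hf.memLp 2))
  · -- covariance of the approximation, read off its coefficients `coeffExt S c ∈ W`
    intro p hp
    refine symmetric_of_mFourierCoeff p.1 (hG p hp) (fun _ _ => rfl) p.2.2
      (Torus.continuous_realTrigPoly _ _) fun k i => ?_
    have hcoef : ∀ k : d → ℤ, mFourierCoeff (EuclideanSpace.complexify ∘
        Torus.realTrigPoly S (Torus.coeffExt S c)) k = Torus.coeffExt S c k := fun k => by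
      rw [Torus.mFourierCoeff_realTrigPoly hS hCsymm]
      by_cases hk : k ∈ S
      · rw [if_pos hk]
      · rw [if_neg hk, Torus.coeffExt_of_not_mem _ hk]
    rw [hcoef, hcoef]
    exact hcW.2 p hp k i
  · -- the tested Galerkin equations
    intro a ha hdiv hband
    have hid := Torus.sum_re_inner_galerkinField_test ν hS (hgr.isConjSymm_coeffExt hS) hCsymm hCT
      ha hdiv hband
    have hzero : ∑ k ∈ S, (inner ℂ (Torus.galerkinField ν S (Torus.coeffExt S g)
        (Torus.coeffExt S c) k) (mFourierCoeff (EuclideanSpace.complexify ∘ a) k)).re = 0 := by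
      refine Finset.sum_eq_zero fun k hk => ?_
      have hk0 : Torus.galerkinField ν S (Torus.coeffExt S g) (Torus.coeffExt S c) k = 0 := by
        have := congrFun h0 ⟨k, hk⟩
        rwa [galerkinRHS_apply] at this
      rw [hk0, inner_zero_left, Complex.zero_re]
    rw [hzero, hGg] at hid
    have hu : Torus.IsSmooth (Torus.realTrigPoly S (Torus.coeffExt S c)) :=
      Torus.isSmooth_realTrigPoly _ _
    have hGs : Torus.IsSmooth (Torus.realTrigPoly S fun k =>
        mFourierCoeff (EuclideanSpace.complexify ∘ f) k) := Torus.isSmooth_realTrigPoly _ _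
    have i1 : Integrable (fun x => ⟪Torus.realTrigPoly S (Torus.coeffExt S c) x,
        Torus.convect (Torus.realTrigPoly S (Torus.coeffExt S c)) a x⟫_ℝ +
        ν * ⟪Torus.realTrigPoly S (Torus.coeffExt S c) x, Torus.laplacian a x⟫_ℝ) volume :=
      ((hu.continuous.inner (hu.convect ha).continuous).add
        ((hu.continuous.inner ha.laplacian.continuous).const_smul ν)).integrable_unitAddTorus
    have i2 : Integrable (fun x => ⟪Torus.realTrigPoly S
        (fun k => mFourierCoeff (EuclideanSpace.complexify ∘ f) k) x, a x⟫_ℝ) volume :=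
      (hGs.continuous.inner ha.continuous).integrable_unitAddTorus
    have i3 : Integrable (fun x => ⟪f x, a x⟫_ℝ) volume :=
      Torus.integrable_inner_of_continuous hfi ha.continuous
    have hforce := integral_inner_realTrigPoly_mFourierCoeff_eq hS (hf.memLp 2)
      (ha.continuous.memLp_of_hasCompactSupport (HasCompactSupport.of_compactSpace _)) hband
    rw [integral_add i1 i2, hforce, ← integral_add i1 i3] at hid
    exact hid.symm

/-- The three generators of `G` as affine symmetries `(σ, ε, b)` have signs `ε = ±1`. [folklore] -/
theorem gpGenerators_sign :
    ∀ p ∈ ([(Equiv.addRight 1, fun _ => 1, 0), (Equiv.refl _, fun _ => -1, 0),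
        (Equiv.refl _, ![1, -1, -1], ![halfPeriod, 0, halfPeriod])] :
          List (Equiv.Perm (Fin 3) × (Fin 3 → ℤ) × UnitAddTorus (Fin 3))),
      ∀ j : Fin 3, p.2.1 j = 1 ∨ p.2.1 j = -1 := by
  simp only [List.mem_cons, List.not_mem_nil, or_false, forall_eq_or_imp, forall_eq]
  exact ⟨fun _ => by simp, fun _ => by simp, fun j => by fin_cases j <;> simp⟩

end StubSymmSteadyGalerkin

/-- **S1 `stub_symmSteadyGalerkinGP`** — `G`-symmetric stationary Galerkin approximations of
`NS_ν(f_GP)` (Temam 1979, Ch. II Thm 1.2 (i), run in the `G`-fixed subspace of the Galerkin phase space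
on the punctured frequency ball `S_N = {0 < |k|² ≤ N²}`): for every `ν > 0` and `N` there is a smooth,
divergence-free, mean-zero, `G`-symmetric field `U`, band-limited to `S_N`, with Temam's a priori bounds
`‖∇U‖² ≤ 4π²Λ`, `∫‖U‖² ≤ Λ`, `Λ = (∫‖f_GP‖²)/(4π²ν)²`, solving the tested Galerkin equations
`∫ (⟪U, (U·∇)a⟫ + ν⟪U, Δa⟫ + ⟪f_GP, a⟫) = 0` for every smooth divergence-free `a` band-limited to `S_N`.
Proof: `StubSymmSteadyGalerkin.exists_symmetric_steady_galerkin_approx` for `f = gpForce` and the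
three generators of `G` (`isGPSymmetric_iff`, `isGPSymmetric_gpForce`), bounds by
`steady_galerkin_bounds`. [cite: Temam1979, Ch. II Thm 1.2 (i)] -/
theorem stub_symmSteadyGalerkinGP :
    ∀ ν : ℝ, 0 < ν → ∀ N : ℕ, ∃ U : UnitAddTorus (Fin 3) → EuclideanSpace ℝ (Fin 3),
      Torus.IsSmooth U ∧ Torus.IsDivFree U ∧ Torus.HasZeroMean U ∧ IsGPSymmetric U ∧
      (∀ k ∉ (Torus.freqBall (d := Fin 3) N).erase 0,
        mFourierCoeff (EuclideanSpace.complexify ∘ U) k = 0) ∧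
      Torus.eGradNormSq U ≤ ENNReal.ofReal (4 * Real.pi ^ 2 *
        ((∫ x, ‖gpForce x‖ ^ 2) / (4 * Real.pi ^ 2 * ν) ^ 2)) ∧
      (∫⁻ x, ‖U x‖ₑ ^ 2 ≤ ENNReal.ofReal ((∫ x, ‖gpForce x‖ ^ 2) / (4 * Real.pi ^ 2 * ν) ^ 2)) ∧
      ∀ a : UnitAddTorus (Fin 3) → EuclideanSpace ℝ (Fin 3), Torus.IsSmooth a → Torus.IsDivFree a →
        (∀ k ∉ (Torus.freqBall (d := Fin 3) N).erase 0,
          mFourierCoeff (EuclideanSpace.complexify ∘ a) k = 0) →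
        ∫ x, (⟪U x, Torus.convect U a x⟫_ℝ + ν * ⟪U x, Torus.laplacian a x⟫_ℝ + ⟪gpForce x, a x⟫_ℝ) = 0 := by
  intro ν hν N
  have hf : Torus.IsSmooth gpForce :=
    (Theorems.SteadyStatesLoudBounded.GpAdmissible.stub_gpAdmissible).1
  obtain ⟨C, hCsymm, hCtr, hCsupp, hCbd, hCcov, hCtest⟩ :=
    StubSymmSteadyGalerkin.exists_symmetric_steady_galerkin_approx hν _
      StubSymmSteadyGalerkin.gpGenerators_sign hf
      ((GPMeanBoundedFamily.StubSymmetricScheme.isGPSymmetric_iff gpForce).1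
        GPMeanBoundedFamily.StubHeadModes.isGPSymmetric_gpForce) N
  have hS : ∀ k ∈ (Torus.freqBall (d := Fin 3) N).erase 0, -k ∈ (Torus.freqBall (d := Fin 3) N).erase 0 :=
    neg_mem_freqBall_erase_zero
  refine ⟨Torus.realTrigPoly ((Torus.freqBall (d := Fin 3) N).erase 0) C,
    Torus.isSmooth_realTrigPoly _ _, Torus.isDivFree_realTrigPoly fun k _ => hCtr k,
    hasZeroMean_realTrigPoly_of_zero_not_mem (by simp) C,
    (GPMeanBoundedFamily.StubSymmetricScheme.isGPSymmetric_iff _).2 hCcov,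
    fun k hk => Torus.mFourierCoeff_realTrigPoly_eq_zero hS hCsymm hk,
    (steady_galerkin_bounds hν hCsymm hCsupp hCbd).1, ?_, hCtest⟩
  -- the `L²` bound
  have h := (steady_galerkin_bounds hν hCsymm hCsupp hCbd).2.1
  have hm : MemLp (Torus.realTrigPoly ((Torus.freqBall (d := Fin 3) N).erase 0) C) 2 volume :=
    Torus.memLp_realTrigPoly _ _ 2
  calc ∫⁻ x, ‖Torus.realTrigPoly ((Torus.freqBall (d := Fin 3) N).erase 0) C x‖ₑ ^ 2
      = ENNReal.ofReal
          (∫ x, ‖Torus.realTrigPoly ((Torus.freqBall (d := Fin 3) N).erase 0) C x‖ ^ 2) := by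
        rw [ofReal_integral_eq_lintegral_ofReal (hm.integrable_norm_pow two_ne_zero)
          (ae_of_all _ fun x => by positivity)]
        refine lintegral_congr fun x => ?_
        rw [← ofReal_norm, ← ENNReal.ofReal_pow (norm_nonneg _)]
    _ ≤ _ := ENNReal.ofReal_le_ofReal h

end Summit.AnomalousDissipation.AnomalousDissipation.Theorems.VirtualDissipation.LightSteadyStatesGP

end
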